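import Summits.HodgeConjecture.HodgeConjecture.Theorems.Ring2HypothesesDescentAbsoluteWeakDomination
import HarnessLib

/-!
# Ring 2 — hypotheses layer, descent axis: DELIGNE–MILNE II COR. 6.27 AT REALISATION LEVEL, WEAK FORM — every variety
# whose even cohomology is spanned by ABSOLUTE HODGE (resp. MOTIVATED) correspondences from the powers of a complex
# abelian variety has all its Hodge classes absolute Hodge (mod c1 [+ c25] + (N)+(E) + CS7 + CS8)

HONEST FRAMING (page 1, verbatim the cell's standing line): **research route conditional on HC_CM; not a
corollary; Q11.4-sentence-2 already refuted in dim ≥ 3.** Nothing in this file proves a case of the Hodge conjecture;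
nothing discharges the binder of record b06 `Ring2.Hypotheses.AbsoluteHodgeImpliesAlgebraicAV` (`Ring2HypothesesDescent.lean`
:73; OPEN); the binder table's numbers do not move. `HC_CM` (`Theses.RankFourFaces.CMAbelianHodge`) does not occur in this
file; row b06 does not occur in this file; its PARENT node `Ring2.Hypotheses.AbsoluteHodgeImpliesAlgebraic` (all varieties,
Charles–Schnell Conj. 11.2.18) occurs once, as the displayed hypothesis `h` of the last theorem, never asserted.

Hodge ladder STAGE 3, `BINDER-OWNERS.md` row **b06**, seat `ring2-b06` (gen 77), second file; companion of
`Ring2HypothesesDescentAbsoluteWeakDomination` (same gen: statement 11.2.17 descends along WEAK absolute-Hodge domination —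
Deligne–Milne II Thm. 6.25's mechanism for an arbitrary generating variety). Here the generator is a complex abelian
variety `A`, on whose powers 11.2.17 is Deligne's Main Theorem 2.11 (c1, displayed; gen 76's
`hodgeClasses_absoluteHodge_pow_abelianVariety_of_deligne`):

* `hodgeClasses_absoluteHodge_of_absoluteHodgeDomination_abelianVariety_of_deligne` — **DM II COR. 6.27, WEAK FORM**: `Y`
  smooth projective with every `H²ᵖ(Y(ℂ); ℂ)` the `ℂ`-span of the images of the actions of classes of `span_ℂ AH(Y ⊗ A.Xᵉ)`
  on the cohomology of the powers `A.Xᵉ` (`h(Y) ∈ ⟨h(A)⟩^⊗ ⊂ M_ℂ^{AH} = M_ℂ^{av}`) ⟹ every rational `(p,p)`-class on `Y`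
  is absolute Hodge (mod c1 + (N)+(E) + CS7 + CS8); `HodgeClassesAreAbsoluteHodgeFor` words. DM's printed 6.27 lists
  products of abelian varieties with curves, unirational threefolds, Fermat hypersurfaces, K3 surfaces — placed in `M^{av}`
  by absolute Hodge correspondences in the proof of 6.26; those placements are NOT supplied here.
* `hodgeClasses_absoluteHodge_of_motivatedDomination_abelianVariety_of_deligne_of_andre` — **«WEAKLY MOTIVATED BY AN
  ABELIAN VARIETY ⟹ ALL HODGE CLASSES ARE ABSOLUTE HODGE»** in ring2-b05 gen 41's cohomological rendering of Arapura's weak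
  motivation (verbatim hypothesis), mod c1 + c25 + the four facts — Arapura Cor. 4.4 composed with André Prop. 2.5.1 (the
  sentence «if `M(X) ∈ M_ab`, then all Hodge classes on `X` are motivated, in particular absolute Hodge», Soldatenkov 2022
  §2.2 after André 1996 §0.6; the K3 case is DM II 6.26 (d)). ring2-b05's own road (`…_motivatedDomination_abelianVariety`,
  Hodge ⟹ motivated on `Y` mod c2, then c25) costs André's Thm. 0.6.2 where this one costs Deligne's 2.11.
* `hodgeConjectureFor_iff_absoluteHodgeClassesAreAlgebraicFor_of_absoluteHodgeDomination_abelianVariety` — on this WEAK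
  abelian class `HodgeConjectureFor ↔ AbsoluteHodgeClassesAreAlgebraicFor` (Charles–Schnell 11.2.18 at `Y`), extending
  gen 76's strict-class statement; and `hodgeConjectureFor_of_absoluteHodgeImpliesAlgebraic_…` — the PARENT node of
  row b06 (displayed hypothesis `h`) gives the Hodge conjecture for every such `Y`.

HONEST COLUMN. Nothing is discharged; «10 · 0» unchanged; c1 `deligne1982_hodgeClasses_abelianVariety_absoluteHodge`,
c25 `Andre1996_isAbsoluteHodgeClass_of_mem_motivatedClasses`, (N), (E), CS7, CS8 displayed, never asserted; the weak
domination hypotheses are inline and never asserted; no definition, no new named fact, no sorry. NOT obtained: as in the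
companion (no product / powers conjunct; no instance of DM 6.26 (b)–(d)).

PRESEARCH: as in the companion — [corpus: book:deligne1982-hodge-cycles-motives-shimura-varieties p0156 (II 6.25–6.27)],
[corpus: paper:arxiv-math_0501348 p0008 (Arapura §4 `AC`, Lemma 4.2, Cor. 4.4)], galaxy all stars: no relevant hit;
certification by assembly, no novelty in print claimed.

References (bib keys): DeligneMilne1982Tannakian (II Thm. 6.25, Prop. 6.26, Cor. 6.27), Deligne1982HodgeCycles
(Introduction pp. 5–7, Main Thm. 2.11), Arapura2006 (§4 Lemma 4.2 and Cor. 4.4), Andre1996Motifs (Prop. 2.5.1 (p. 18),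
Thm. 0.6.2 (p. 9)), Soldatenkov2022 (§2.2), CharlesSchnell2014Notes (§11.2.5 statements 11.2.17–11.2.18).
-/

noncomputable section

set_option linter.dupNamespace false

open CategoryTheory AlgebraicGeometry MonoidalCategory CartesianMonoidalCategory
open Literature.AlgebraicTopology.SingularHomology Literature.Geometry.Kaehler
open Literature.AlgebraicGeometry Literature.AlgebraicGeometry.Motives
open Literature.AlgebraicGeometry.HodgeTheory
open Summit.HodgeConjecture.HodgeConjecture.Theorems

namespace Summit.HodgeConjecture.HodgeConjecture.Ring2.Hypotheses


/-! ## §4 Deligne–Milne II Cor. 6.27 at realisation level, weak form (mod c1 + (N)+(E) + CS7 + CS8) -/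

section Abelian

variable {dY : ℕ} {Y : SchemeOver ℂ}

/-- **DELIGNE–MILNE II COR. 6.27, WEAK FORM ON THE REAL CARRIERS** (mod c1 + (N)+(E) + CS7 + CS8): let `A` be a complex
abelian variety and `Y` smooth projective of dimension `dY` such that `H²ᵖ(Y(ℂ); ℂ)` is the `ℂ`-span of the images of the
actions of classes of `span_ℂ AH(Y ⊗ A.Xᵉ)` on the cohomology of the powers `A.Xᵉ` — `h(Y) ∈ ⟨h(A)⟩^⊗ ⊂ M_ℂ^{AH}` read in
degree `2p`. Then every rational `(p,p)`-class on `Y` is absolute Hodge: §2 with 11.2.17 on the powers `A.Xᵉ`, which is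
Deligne's Main Theorem 2.11 (c1, the displayed hypothesis `hD`, NOT asserted; gen 76's
`hodgeClasses_absoluteHodge_pow_abelianVariety_of_deligne`). DM's printed 6.27 lists products of abelian varieties with
curves, unirational threefolds, Fermat hypersurfaces and K3 surfaces — all placed in `M^{av}` by absolute Hodge
correspondences (proof of 6.26); those placements are NOT supplied here.
[cite: DeligneMilne1982Tannakian, II Thm. 6.25, Prop. 6.26 and Cor. 6.27] [cite: Deligne1982HodgeCycles, Main Thm. 2.11] -/
theorem hodgeClasses_absoluteHodge_of_absoluteHodgeDomination_abelianVariety_of_deligne (hN : chartConjugation_canonical)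
    (hex : ∀ ⦃n : ℕ⦄ ⦃X : SchemeOver ℂ⦄, IsSmoothProjective n X →
      ∀ (σ : ℂ ≃+* ℂ) (p : ℕ) (c : complexBetti X (2 * p)), ∃ s, IsConjugateClass σ X (2 * p) c s)
    (hcup : deligne1982_cupProduct_absoluteHodge) (hgys : deligne1982_gysinFst_absoluteHodge)
    (hD : deligne1982_hodgeClasses_abelianVariety_absoluteHodge) (A : AbelianVariety ℂ) (hY : IsSmoothProjective dY Y)
    (p : ℕ)
    (hdom : Submodule.span ℂ
        {c : complexBetti Y (2 * p) |
          ∃ (e cd d : ℕ) (hab : 2 * d + 2 * cd = 2 * p + 2 * (e * A.dim))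
            (u : complexBetti (Y ⊗ A.X.pow e) (2 * cd)),
            u ∈ Submodule.span ℂ {c : complexBetti (Y ⊗ A.X.pow e) (2 * cd) |
                IsAbsoluteHodgeClass (dY + e * A.dim) (Y ⊗ A.X.pow e) cd c} ∧
              c ∈ LinearMap.range
                (corrAction complexOrientationFamily hY ((AbelianVariety.isSmoothProjective_holds (A := A)).pow e)
                  hab u)} = ⊤)
    {c : complexBetti Y (2 * p)} (hc : IsRationalClass c) (hpp : IsOfHodgeType dY Y (2 * p) p p c) :
    IsAbsoluteHodgeClass dY Y p c :=
  isAbsoluteHodgeClass_of_absoluteHodgeDomination hN hex hcup hgys AbelianVariety.isSmoothProjective_holds hY p hdom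
    (hodgeClasses_absoluteHodge_pow_abelianVariety_of_deligne hN hex hD A) hc hpp

/-- **… in Charles–Schnell's words: 11.2.17 holds at every `Y` of the WEAK abelian class** (even cohomology spanned by
absolute Hodge correspondences from the powers of one abelian variety), mod c1 + the four facts — gen 76's
`hodgeClassesAreAbsoluteHodgeFor_of_isDominatedByPowers_abelianVariety_of_deligne` (strict class) extended.
[cite: DeligneMilne1982Tannakian, II Thm. 6.25 and Cor. 6.27] [cite: CharlesSchnell2014Notes, §11.2.5 statement 11.2.17] -/
theorem hodgeClassesAreAbsoluteHodgeFor_of_absoluteHodgeDomination_abelianVariety_of_deligne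
    (hN : chartConjugation_canonical)
    (hex : ∀ ⦃n : ℕ⦄ ⦃X : SchemeOver ℂ⦄, IsSmoothProjective n X →
      ∀ (σ : ℂ ≃+* ℂ) (p : ℕ) (c : complexBetti X (2 * p)), ∃ s, IsConjugateClass σ X (2 * p) c s)
    (hcup : deligne1982_cupProduct_absoluteHodge) (hgys : deligne1982_gysinFst_absoluteHodge)
    (hD : deligne1982_hodgeClasses_abelianVariety_absoluteHodge) (A : AbelianVariety ℂ) (hY : IsSmoothProjective dY Y)
    (hdom : ∀ p : ℕ, Submodule.span ℂ
        {c : complexBetti Y (2 * p) |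
          ∃ (e cd d : ℕ) (hab : 2 * d + 2 * cd = 2 * p + 2 * (e * A.dim))
            (u : complexBetti (Y ⊗ A.X.pow e) (2 * cd)),
            u ∈ Submodule.span ℂ {c : complexBetti (Y ⊗ A.X.pow e) (2 * cd) |
                IsAbsoluteHodgeClass (dY + e * A.dim) (Y ⊗ A.X.pow e) cd c} ∧
              c ∈ LinearMap.range
                (corrAction complexOrientationFamily hY ((AbelianVariety.isSmoothProjective_holds (A := A)).pow e)
                  hab u)} = ⊤) :
    HodgeClassesAreAbsoluteHodgeFor dY Y :=
  ⟨nonempty_hodgeModel_holds hY, fun p _ hc hpp ↦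
    hodgeClasses_absoluteHodge_of_absoluteHodgeDomination_abelianVariety_of_deligne hN hex hcup hgys hD A hY p (hdom p)
      hc hpp⟩

/-- **«WEAKLY MOTIVATED BY AN ABELIAN VARIETY ⟹ ALL HODGE CLASSES ARE ABSOLUTE HODGE»** (Arapura Cor. 4.4 composed
with André Prop. 2.5.1 — the sentence «if `M(X) ∈ M_ab`, then all Hodge classes on `X` are motivated, in particular
absolute Hodge» (Soldatenkov 2022 §2.2 after André 1996); the K3 case is DM II 6.26 (d) / André's Kuga–Satake
argument), in ring2-b05's cohomological rendering of weak motivation, mod c1 + c25 + (N)+(E) + CS7 + CS8: c1 gives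
11.2.17 on the powers `A.Xᵉ`, c25 turns motivated generators into absolute Hodge ones (§3), §2 descends. The companion
road through «Hodge ⟹ motivated on `Y`» (ring2-b05's `hodgeClasses_motivated_of_motivatedDomination_abelianVariety`, mod
c2) followed by c25 costs André's Thm. 0.6.2 instead of Deligne's 2.11. c1, c25 displayed, NOT asserted.
[cite: Arapura2006, §4 Cor. 4.4 and Lemma 4.2] [cite: Andre1996Motifs, Prop. 2.5.1 (p. 18)] [cite: Soldatenkov2022, §2.2]
[cite: DeligneMilne1982Tannakian, II Prop. 6.26 (d) and Cor. 6.27] -/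
theorem hodgeClasses_absoluteHodge_of_motivatedDomination_abelianVariety_of_deligne_of_andre
    (hN : chartConjugation_canonical)
    (hex : ∀ ⦃n : ℕ⦄ ⦃X : SchemeOver ℂ⦄, IsSmoothProjective n X →
      ∀ (σ : ℂ ≃+* ℂ) (p : ℕ) (c : complexBetti X (2 * p)), ∃ s, IsConjugateClass σ X (2 * p) c s)
    (hcup : deligne1982_cupProduct_absoluteHodge) (hgys : deligne1982_gysinFst_absoluteHodge)
    (hD : deligne1982_hodgeClasses_abelianVariety_absoluteHodge)
    (hA : Andre1996_isAbsoluteHodgeClass_of_mem_motivatedClasses) (A : AbelianVariety ℂ) (hY : IsSmoothProjective dY Y)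
    (p : ℕ)
    (hdom : Submodule.span ℂ
        {c : complexBetti Y (2 * p) |
          ∃ (e cd d : ℕ) (hab : 2 * d + 2 * cd = 2 * p + 2 * (e * A.dim))
            (u : complexBetti (Y ⊗ A.X.pow e) (2 * cd)),
            u ∈ motivatedClasses (dY + e * A.dim) (Y ⊗ A.X.pow e) cd ∧
              c ∈ LinearMap.range
                (corrAction complexOrientationFamily hY ((AbelianVariety.isSmoothProjective_holds (A := A)).pow e)
                  hab u)} = ⊤)
    {c : complexBetti Y (2 * p)} (hc : IsRationalClass c) (hpp : IsOfHodgeType dY Y (2 * p) p p c) :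
    IsAbsoluteHodgeClass dY Y p c :=
  isAbsoluteHodgeClass_of_motivatedDomination_of_andre hN hex hcup hgys hA AbelianVariety.isSmoothProjective_holds hY p
    hdom (hodgeClasses_absoluteHodge_pow_abelianVariety_of_deligne hN hex hD A) hc hpp

/-- **On every `Y` of the weak abelian class, `HodgeConjectureFor dY Y ↔ AbsoluteHodgeClassesAreAlgebraicFor dY Y`**
(Charles–Schnell 11.2.18 at `Y`), mod c1 + (N)+(E) + CS7 + CS8: `⟸` by 11.2.17 at `Y` (this §) and the lane's splitting
`hodgeConjectureFor_of_absoluteHodge_of_algebraic`; `⟹` is fact-free. Extends gen 76's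
`hodgeConjectureFor_iff_absoluteHodgeClassesAreAlgebraicFor_of_isDominatedByPowers_abelianVariety` (strict class) to the
weak class. Neither side is asserted. [cite: CharlesSchnell2014Notes, §11.2.5 statements 11.2.17–11.2.18]
[cite: DeligneMilne1982Tannakian, II Cor. 6.27] -/
theorem hodgeConjectureFor_iff_absoluteHodgeClassesAreAlgebraicFor_of_absoluteHodgeDomination_abelianVariety
    (hN : chartConjugation_canonical)
    (hex : ∀ ⦃n : ℕ⦄ ⦃X : SchemeOver ℂ⦄, IsSmoothProjective n X →
      ∀ (σ : ℂ ≃+* ℂ) (p : ℕ) (c : complexBetti X (2 * p)), ∃ s, IsConjugateClass σ X (2 * p) c s)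
    (hcup : deligne1982_cupProduct_absoluteHodge) (hgys : deligne1982_gysinFst_absoluteHodge)
    (hD : deligne1982_hodgeClasses_abelianVariety_absoluteHodge) (A : AbelianVariety ℂ) (hY : IsSmoothProjective dY Y)
    (hdom : ∀ p : ℕ, Submodule.span ℂ
        {c : complexBetti Y (2 * p) |
          ∃ (e cd d : ℕ) (hab : 2 * d + 2 * cd = 2 * p + 2 * (e * A.dim))
            (u : complexBetti (Y ⊗ A.X.pow e) (2 * cd)),
            u ∈ Submodule.span ℂ {c : complexBetti (Y ⊗ A.X.pow e) (2 * cd) |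
                IsAbsoluteHodgeClass (dY + e * A.dim) (Y ⊗ A.X.pow e) cd c} ∧
              c ∈ LinearMap.range
                (corrAction complexOrientationFamily hY ((AbelianVariety.isSmoothProjective_holds (A := A)).pow e)
                  hab u)} = ⊤) :
    HodgeConjectureFor dY Y ↔ AbsoluteHodgeClassesAreAlgebraicFor dY Y :=
  ⟨AbsoluteHodgeClassesAreAlgebraicFor.of_hodgeConjectureFor,
    hodgeConjectureFor_of_absoluteHodge_of_algebraic
      (hodgeClassesAreAbsoluteHodgeFor_of_absoluteHodgeDomination_abelianVariety_of_deligne hN hex hcup hgys hD A hY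
        hdom)⟩

/-- **The PARENT node of row b06 decides the Hodge conjecture on the whole weak abelian class**: Charles–Schnell's
Conjecture 11.2.18 for all varieties (`Ring2.Hypotheses.AbsoluteHodgeImpliesAlgebraic`, the displayed hypothesis `h`, NOT
asserted) gives `HodgeConjectureFor dY Y` for every smooth projective `Y` whose even cohomology is spanned by absolute
Hodge correspondences from the powers of a complex abelian variety, mod c1 + (N)+(E) + CS7 + CS8 — Deligne's «absolute
Hodge ⟹[?] algebraic» step on the class where his «Hodge ⟹ absolute Hodge» is a theorem. Nothing of row b06 is claimed.
[cite: Deligne1982HodgeCycles, Introduction (pp. 5–7) and Main Thm. 2.11] [cite: DeligneMilne1982Tannakian, II Cor. 6.27]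
[cite: CharlesSchnell2014Notes, §11.2.5 Conj. 11.2.18] -/
theorem hodgeConjectureFor_of_absoluteHodgeImpliesAlgebraic_of_absoluteHodgeDomination_abelianVariety
    (hN : chartConjugation_canonical)
    (hex : ∀ ⦃n : ℕ⦄ ⦃X : SchemeOver ℂ⦄, IsSmoothProjective n X →
      ∀ (σ : ℂ ≃+* ℂ) (p : ℕ) (c : complexBetti X (2 * p)), ∃ s, IsConjugateClass σ X (2 * p) c s)
    (hcup : deligne1982_cupProduct_absoluteHodge) (hgys : deligne1982_gysinFst_absoluteHodge)
    (hD : deligne1982_hodgeClasses_abelianVariety_absoluteHodge) (h : AbsoluteHodgeImpliesAlgebraic)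
    (A : AbelianVariety ℂ) (hY : IsSmoothProjective dY Y)
    (hdom : ∀ p : ℕ, Submodule.span ℂ
        {c : complexBetti Y (2 * p) |
          ∃ (e cd d : ℕ) (hab : 2 * d + 2 * cd = 2 * p + 2 * (e * A.dim))
            (u : complexBetti (Y ⊗ A.X.pow e) (2 * cd)),
            u ∈ Submodule.span ℂ {c : complexBetti (Y ⊗ A.X.pow e) (2 * cd) |
                IsAbsoluteHodgeClass (dY + e * A.dim) (Y ⊗ A.X.pow e) cd c} ∧
              c ∈ LinearMap.range
                (corrAction complexOrientationFamily hY ((AbelianVariety.isSmoothProjective_holds (A := A)).pow e)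
                  hab u)} = ⊤) :
    HodgeConjectureFor dY Y :=
  (hodgeConjectureFor_iff_absoluteHodgeClassesAreAlgebraicFor_of_absoluteHodgeDomination_abelianVariety hN hex hcup hgys
      hD A hY hdom).2 ⟨nonempty_hodgeModel_holds hY, fun p c hAH ↦ h hY p c hAH⟩

end Abelian

/-! ## Audit: nothing is decided here

Every theorem above is an implication out of displayed named facts of record (c1 `hD`, c25 `hA`, (N) `hN`, (E) `hex`,
CS7 `hcup`, CS8 `hgys`) and displayed OPEN hypotheses (weak domination, the parent node `h`), or an equivalence between
two OPEN per-variety statements modulo them; `HC_CM`, `HC_AV`, row b06 do not occur. -/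

end Summit.HodgeConjecture.HodgeConjecture.Ring2.Hypotheses

end
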